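import Literature.MathematicalPhysics.QuantumFieldTheory.Balaban1983to89.B9

/-!
# `Balaban1983to89.B9Carve07Thm37Hyp` — [B9] pp. 403–409 (Corollary 3.5, Corollary 3.6, Theorem 3.7 and the proof displays
# (3.63)–(3.89)) CARVED: the section's printed statements conjoined BY NAME into one hypothesis bundle `Hyp` keyed to
# `stmt-QuantumFields-20542` (also feeds `stmt-QuantumFields-19200`), the two p. 403 sentences that no declaration of the
# tree states typed hypothesis-form, and the in-tree citation index of the block's sixteen SKELETON rows

statement-level skeleton of published theorems with citation tags; proofs where landed; nothing here is a claim about the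
Yang–Mills mass gap

CITATION HEADER (lean-in-tree rule).  B9 = T. Bałaban, *Propagators for lattice gauge theories in a background field*,
Commun. Math. Phys. **99** (1985) 389–434 [Balaban1985BackgroundPropagators] (doi:10.1007/bf01240355; held
`paper:balaban1985-cmp99-background-propagators`, journal page = PDF page + 388; text layer `pNNNN.txt` of `lit read`; the
page renders `pub/pub-balaban/b2b-balaban-ref1/pages/1985-cmp99-background-propagators/…-p014-x2.png … -p022-x2.png` of
pp. 402–410 were READ AS IMAGES by this seat, 2026-08-28); [4] = B6 = T. Bałaban, *Propagators and renormalization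
transformations for lattice gauge theories. II*, Commun. Math. Phys. **96** (1984) 223–250 [Balaban1984PropagatorsII];
[5] = B7 = T. Bałaban, *Averaging operations for lattice gauge theories*, Commun. Math. Phys. **98** (1985) 17–51
[Balaban1985Averaging].  Cell `lit-balaban`, P6 CARVING FAN (D-0154 (3b)), BLOCK 07 of `carve/BLOCKS-01-10.md` (lead g29,
2026-08-28T03:22Z): source section = [B9] Sect. B (end) and Sect. C (opening), journal pp. 403–409 [PDF 15–21]; KEY item
`stmt-QuantumFields-20542` (K1⁷, lane N06 [B9]); also feeds `stmt-QuantumFields-19200` (M5.5 `B9Thm37GpTorusRegular*` is in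
the tree — cited below, not touched).  Seat `lit-balaban-carve-07` (literature-prover-lit-balaban-carve-07-0).  Rules
`carve/CARVE-RULES.md`: in tree = cite, never restate; hypothesis form; no `instance`, no `notation`; 0 sorry; desk stems
(`B9Thm37GpTorusRegular*`, `B9CubeSequence408*`, `B9Eq3104*`, `B9Thm310*`, `B9B8*`, `B8Thm2Torus*`, `B8Prop5*`) untouched.

WHAT THIS FILE IS.  The block is IN TREE at statement level (16 SKELETON rows of v3.365: 3 typed-existing, 11
proved-existing, 2 proved).  Accordingly this file (i) RESTATES NOTHING that has a declaration: every row is cited by name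
in the INDEX below, and the rows' HYPOTHESIS-FORM declarations are USED, by name, in the bundle `Hyp` (the rows realised by
PROVED theorems or by definitions with bodies are cited only — a proved statement is not a hypothesis); (ii) types,
hypothesis-form over the abstract carriers of `…Balaban1983to89.B9` (`B9.Geometry`, `B9.Backgrounds`, `B9.KernelFamily`,
`B9.SiteKernel`, `B9.FineKernel`), the two printed sentences of p. 403 that no declaration of the tree states as printed —
`Remainders365Printed` (p. 403, printed lines 5–8 = text layer `p0015.txt:L6–L9`) and `RPExtend349Printed` (p. 403, `p0015.txt:L30–L32`) —
in the CONDITIONAL frame of Sect. B used by the cell's `B9.SectBStepPrinted` (p. 402 [PDF 14]: «We assume that Theorem 3.1 is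
valid for the operator G′(U)»); (iii) defines ONE bundle `Hyp` = the conjunction, by name, of the section's printed statements
and printed proof leaves; (iv) records (§3, pointers) and kernel-checks (§4, v1.2: bookkeeping theorems over the bundle —
the nine projections `Hyp.sectB` … `Hyp.rwSums`, the deliveries `Hyp.thm31`, `Hyp.thm33`, `Hyp.thm34`, `Hyp.thms31to34`,
and the minimal-leaves form `hyp_of_leaves`; nothing printed is proved here) how the bundle delivers the section's
numbered statements through the tree's own theorems (`B9.cor35_of_sectB_base`, `B9.cor36_of_cor35`, `B9.thm31_of_thm37`,
`B9.thm34_of_sectB`).  It moves no node count and proves no summit statement.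

INDEX — the sixteen SKELETON rows of block 07 — row id · printed item · page: journal [PDF] (text-layer lines) · IN-TREE
declarations cited BY NAME (all under `Literature.MathematicalPhysics.QuantumFieldTheory.Balaban1983to89.`; «used» =
conjoined in `Hyp` below; «proved» ∕ «def» = a theorem ∕ a definition with body in the tree, hence not a hypothesis here):
* B9.Cor3.5 · Corollary 3.5 · p. 407 [19] (`p0019.txt:L32–L38`) · `B9.Cor35Printed` (used); its printed proof sentence
  «There we have proved these theorems for operators with the external gauge field configuration U = 1» = `B9.BaseU1Printed`
  (used); `B9.cor35_of_sectB_base` (proved bookkeeping); `B9.Cor35_U1_Shape`; letters level `B9Cor35AtOneInverseLetters`,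
  `B9Cor35ComparisonsGpC` ∕ `…GA` ∕ `…EH` (cited only).
* B9.Cor3.6 · Corollary 3.6 · p. 408 [20] (`p0020.txt:L8–L12`) · `B9.Cor36Printed` (used); the leaf of its printed proof
  «we have to recall only that all the results of these theorems are gauge invariant» = `B9.GaugeReduction335` (used);
  `B9.cor36_of_cor35` (proved); concrete `B9Cor36GaugeReductionCube.thms31to33_cube_of_reg335`,
  `B9Eq387CubeReductionGaugeBackground` (cited only).
* B9.Thm3.7 · Theorem 3.7 (3.90) · p. 409 [21] (`p0021.txt:L27–L33`) · `B9.Thm37Printed` (used); the summation leaf (p. 409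
  «so we may apply them here also», p. 410 ll. 1–5, p. 416) = `B9.RWSumsYieldIneqs` (used; its G-half belongs to Theorem 3.10,
  block 09); `B9.thm31_of_thm37` (proved; p. 410 «Theorem 3.7 implies that all the inequalities (3.42)–(3.47) hold for G′»);
  the whole leaf INHABITED over the expansion letters: `B9Thm37Whole.thm37Printed_of_local342`,
  `B9Thm37Whole.thm37Printed_of_cor36Printed` (proved from the schemas `B9Thm37Whole.Local342`, `Identities`, `StaticOK`,
  `Sizes.Bounded`); torus with regular background (M5.5, desk G-B9-LETTERS): `B9Thm37GpTorusRegular`,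
  `B9Thm37GpTorusRegularCubes`, `B9Thm37GpTorusRegularEntries` (cited only).
* (3.63)–(3.65) · p. 402 [14] · row B9.Eq3.62 of BLOCK 06 — `B9Thm34Ext.neumannInverse_majorant`, `B9Eq360Vprime.eq362` ∕
  `eq364` ∕ `eq365_left` ∕ `eq365_right` (proved); listed for continuity only.
* B9.Eq3.66 · the expansion of Q′(U′U)G′²(U′U)Q′*(U′U) with C′(A), (3.66), (3.67), «The inverse satisfies Theorem 3.2» ·
  p. 403 [15] (`p0015.txt:L10–L29`) · `B9Thm34Inv.ineq367_of_366_348` (proved), `B9Thm34Inv.inverse_satisfies_thm32`,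
  `B9Thm34Inv.isUnit_ext` ∕ `inv_majorant_of_367`; `B9Eq360Vprime.eq365b` ∕ `cPrime`; `B9Ineq366CPrime.ineq366_kernel`.
* B9.Eq3.68 · (3.68) · p. 403 [15] (`p0015.txt:L32–L34`) · `B9Eq386Neumann.pOne` (def), `B9Eq360Vprime.pPrime` ∕ `eq368` ∕
  `pPrime_explicit` («The remainder can be written explicitly …»), `B9Thm34PPrimeKernelFinal.thm34_pPrime_kernel_final` ∕
  `thm34_R_kernel_final` (proved, kernel form).
* B9.Eq3.69 · (3.69) with the unnumbered display «|Re(U′U)(∂p) − 1|, |Im(U′U)(∂p)| ≤ O(1)(Mα₀ + α₁)ξ², ξ = L^{−j}» ·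
  p. 404 [16] · `B9Eq369Small.eq369` (proved), `B9Eq369Small.eq369_local`, `B9Eq369Product.eq369_prodCfg` ∕
  `re_im_prodCfg_le_printed`; the sentence «for the difference Δ′(U′U) − Δ′(U) … additional factor α₁»:
  `B9Eq373V3.eq369_diff`, `B9Eq382V3Letters.eq369_diff_local` (proved).
* B9.Eq3.70 · (3.70) · p. 404 [16] · `B9Eq370Expansion.covD_prodCfg` (proved), `B9Eq370Expansion.covD_prodCfg_expand`.
* B9.Eq3.71 · (3.71)–(3.73), «The constant O(1) is an absolute constant depending on d only» · pp. 404–405 [16–17] ·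
  `B9Eq371Composition.lapDD` (def), `B9Eq371Composition.lapDD_prodCfg` ((3.71)), `norm_F₁op_le_printed` ((3.72)),
  `norm_V₁op_le_printed` ((3.73)) (proved, constants explicit); locality `B9Eq372Locality.norm_V₁op_le_st_printed`.
* B9.Eq3.74 · (3.74)–(3.75) · p. 405 [17] · `B9Eq370Expansion.covDstar_prodCfg` (proved), `covDstar_prodCfg_expand`,
  `B9Eq375Composition.gradDiv_prodCfg`, `norm_F₂op_le_printed`, `norm_V₂op_le_printed`.
* B9.Eq3.76 · (3.76)–(3.77) · pp. 405–406 [17–18] · `B9Eq386Neumann.eq376` (proved), `eq376_line1`; (3.77)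
  `B9Ineq377POne.ineq377_op`, `B9Ineq377POneConcrete.ineq377_concreteE` (proved).
* B9.Eq3.78 · (3.78)–(3.81), the one-step «Q(exp iBV) = Q(V) + F₂(B)», (3.79), and «Q*_j(U′U) = Q*_j(U) + F*_{2,j}(A)» ·
  p. 406 [18] · `B9Eq380Telescope.prodDesc` (def), `prodDesc_telescope` ((3.80)), `norm_teleSum_le_printed` ((3.81); the size
  «|B_n| < O(1)α₁Lⁿξ» by Proposition 6 of [5] = `B7.Prop6Printed` enters as its binder), `prodAsc_telescope` ∕
  `star_teleSum` (the Q*_j twin), `B9.eq381_scale_sum` (proved).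
* B9.Eq3.82 · (3.82)–(3.84), (3.83) · p. 407 [19] · `B9Eq386Neumann.eq382` (proved), `eq384_sub`, `eq384_factor`,
  `vThree` ∕ `pTwo` ∕ `vTotal` (defs); (3.83) `B9Ineq385VG.ineq383_op`; `B9Eq382V3Operator.eq382_V₃` (proved).
* B9.Eq3.85 · (3.85)–(3.86), «Thus Theorem 3.4 is proved, assuming that Theorems 3.1–3.3 hold» · p. 407 [19]
  (`p0019.txt:L31`) · `B9Eq386Neumann.gNew` (def), `gNew_eq_tsum`, `isUnit_sub`, `B9Ineq385VG.ineq385_op`,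
  `B9Eq386NeumannAnalytic.analyticAt_gNew_comp` (proved); the printed conclusion = `B9.SectBStepPrinted` (used) with
  `B9.thm34_of_sectB` (proved).
* B9.Def@408 · the Sect. C setting: 𝒟_j, «Σ_□ h²_□ = 1», □̃ⁿ, M = KR₀M₀, {Ω_n(□)}, «Ω₀(□) ⊂ □̃⁵» · p. 408 [20] ·
  `B9SectCLocalSeq.Omega` (def), `B9SectCLocalSeq.Omega_subset_tilde_five`, `cond22_local`, `B9SectCCubes.box` ∕ `tilde`,
  `B9SectCRefine.refine_pu`, `B9.p408_domains_fit` (proved); desk M5.1a ∕ M5.1c `B9CubeSequence408*` (cited only).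
* B9.Eq3.87 · (3.87), (3.88), «Δ′_aG′₀ = I − Σ_□K(h_□)G′_□h_□ = I − R′» · p. 409 [21] (`p0021.txt:L12`) · `B9Thm37Sum.mulOp`
  (def), `B9Thm37Sum.eq388_sum`, `fixedPoint_of_388`, `B9Thm37Glue.leibRem` (proved ∕ defs); the hypothesis schemas
  `B9Thm37Whole.Ops`, `B9Thm37Whole.Identities`, `B9Thm37Whole.StaticOK`.
* B9.Eq3.89 · (3.89), «It is exactly the bound (2.44) of [4], rescaled to η-scale» · p. 409 [21] (`p0021.txt:L22–L23`) ·
  `B9Thm37Glue.h389_of_342` (proved from (3.42) for G′_□), `B6RandomWalkHom.b9_389_of_342`, `B9Thm37Whole.Sizes.Bounded`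
  (the O(M⁻¹)), `B9Thm37CommutatorBound389` (proved, p38).
The p. 409 sentence «the sequence {Ω_n(□)} satisfies the assumptions of Corollary 3.6. The operators constructed for this
sequence, which we denote by G′_□(U), C_□(U) = (Q′(U)G′_□²(U)Q′*(U))⁻¹, G_□(U), satisfy all the inequalities of Theorems
3.1–3.3 correspondingly» is `B9.Cor36Printed` at the members with `InCube i` (used) ∕ `B9Thm37Whole.Local342`,
`B9Thm37Whole.local342_of_cor36Printed` (proved); «the number O(1) in the condition (3.35) can be taken as equal to 12» is
the parameter `c35` of `B9.Backgrounds.Reg335`.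
The further STATEMENT-LEVEL declarations whose locator falls in pp. 403–409 (`carve/CARVE-LIST.md` v4, Block 07: seven, of
which `B9.BaseU1Printed`, `B9.Cor35Printed`, `B9.Cor36Printed`, `B9.Thm37Printed` are conjoined in `Hyp`) are CITED, not
conjoined, for the stated reasons: `B9.Cor35_U1_Shape` (Cor. 3.5 p. 407 — r1's shape-only predecessor, superseded by
`B9.Cor35Printed` and implied by the conjunct `B9.BaseU1Printed` through `B9.cor35_U1_shape_of_base`); `B9.Thm37_39_310Printed`
(Thms 3.7 + 3.9 + 3.10 (3.90) pp. 409–416 — r1's JOINT leaf over the abstract predicates `HasRWExp`, `HasRWExpInv`, spanning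
blocks 07–09; its Theorem 3.7 part is the conjunct `B9.Thm37Printed` of b09's per-theorem typing); `B9Eq380Telescope.teleSumPrinted`
((3.80) p. 406 — the telescoping sum AS PRINTED, a term with body recording the print's index slip,
`B9Eq380Telescope.telescope_printed_index_fails` ∕ `telescope_correct_index_example`; not a proposition).

HONEST SCOPE.  (a) `Remainders365Printed` and `RPExtend349Printed` are HYPOTHESIS SCHEMAS of printed shape over abstract
carriers: the remainder operators `Rem₁`, `Rem₂`, the fine kernel `P` of P(·) and the analyticity predicate `IsAnalyticExtF`
are LETTERS named by the user, exactly as the `B9.KernelFamily` instances and `IsAnalyticExt` are in `…Balaban1983to89.B9`;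
nothing identifies them with compositions of G′, V′, Q′, (Q′G′²Q′*)⁻¹.  In tree and NOT restated: the (3.42)-members of the
remainder sentence are PROVED (`B9Thm34Ext.remainder_entry1`, `B9Eq365RemainderKernel.remainder365_kernel_final`,
`B9Eq365RemainderKernelUniform.remainder365_kernel_uniform`), and (3.49) for P(U′U) is PROVED in concrete kernel form
(`B9Thm34PPrimeKernelFinal.thm34_R_kernel_final`); the FULL printed sentences — all members (3.42)–(3.47) of «satisfy
Theorem 3.1» (cell GAPS G-B9-02), and the analytic-extension clause for R, P with (3.49) at the family level on the class
(3.37) (`B9.Thm34Printed` types the extension clause for G′ and G only) — had no declaration.  (b) The bundle `Hyp` conjoins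
the numbered statements AND their printed proof leaves; the redundancy is print's and §3 makes it explicit.  (c) No
`instance`, no `notation`, 0 sorry; imports `…Balaban1983to89.B9` only.  NOT a node discharge, NOT summit progress; nothing
continuum, nothing about the mass gap.
-/

namespace Literature.MathematicalPhysics.QuantumFieldTheory.Balaban1983to89.B9Carve07Thm37Hyp

/-! ## §1 The two p. 403 sentences with no declaration in the tree (hypothesis form) -/

/-- **p. 403 [PDF 15], printed lines 2–8** (text layer `p0015.txt:L3–L9`), verbatim: «Now applying Theorem 3.1 for G′(U), the bound
(3.63), the representation (3.64) and Lemma 2.1 of [4] we can prove all the statements (3.42)–(3.47) of Theorem 3.1 for the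
operator G′(U′U), of course with different constants, although changes are small. We define new constants in such a way that
the statements of Theorem 3.1 hold for extended operators. This allows us to formulate a statement concerning the remainders
G′(U)V′(A)G′(U′U) and G′(U′U)V′(A)G′(U) in (3.65). They satisfy Theorem 3.1 with the additional small factor O(1)α₁.»
TYPED (the last two sentences) in the conditional frame of Sect. B (p. 402: «We assume that Theorem 3.1 is valid for the
operator G′(U)»; the frame of `B9.SectBStepPrinted`): for every choice of Theorem 3.1's constants (B₀, δ₀, B₀(·), B′₀(·),
B′₀(·,·)) at U there are an M-threshold M₀, a₁ > 0, an α₀-threshold a₀, the O(1) =: C > 0 and new constants (B₀′, δ₀′,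
B₀′(·), B′₀′(·), B′₀′(·,·)) — all before the member i — such that for M ≥ M₀, every U satisfying (3.35) (`Reg335 c35 α₀ U`)
with Mα₀ ≤ a₀ at which (3.42)–(3.47) hold for G′(U) (`B9.Ineq342_346_347`, `B9.Ineq343_345`), every α₁ ≤ a₁ and every U′ of
the class (3.37) (`Cplx337 α₁ U U'`): EACH of the two remainders — read, like G′(U′U) in `B9.Thm34Printed`, as a kernel
family `Rem₁ i U`, `Rem₂ i U` (letters named by the user) evaluated at the configuration U′U — satisfies (3.42)–(3.47) with
every constant B₀′, B₀′(β), B′₀′(ε), B′₀′(ε, β) multiplied by Cα₁.  In tree, PROVED and therefore cited, not restated: the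
(3.42)-members — `B9Thm34Ext.remainder_entry1`, `B9Eq365RemainderKernel.remainder365_kernel_final`,
`B9Eq365RemainderKernelUniform.remainder365_kernel_uniform`; the Hölder ∕ L² ∕ weighted members (3.43)–(3.47) of the sentence
had no declaration (cell GAPS G-B9-02). [cite: Balaban1985BackgroundPropagators, p.403 lines 5–8 (after (3.65)) + Thm 3.1 (3.42)–(3.47) pp.397–398] -/
def Remainders365Printed {I : Type} (c35 : ℝ) (geo : I → B9.Geometry) (bg : I → B9.Backgrounds)
    (Gp : ∀ i, B9.KernelFamily (geo i) (bg i))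
    (Rem₁ Rem₂ : ∀ i, (bg i).Cfg → B9.KernelFamily (geo i) (bg i)) : Prop :=
  ∀ (B₀ δ₀ : ℝ) (Bβ Bε : ℝ → ℝ) (Bεβ : ℝ → ℝ → ℝ),
    ∃ M₀ a₁ a₀ C B₀' δ₀' : ℝ, ∃ Bβ' Bε' : ℝ → ℝ, ∃ Bεβ' : ℝ → ℝ → ℝ,
      0 < M₀ ∧ 0 < a₁ ∧ 0 < a₀ ∧ 0 < C ∧ 0 < B₀' ∧ 0 < δ₀' ∧
      ∀ i : I, M₀ ≤ (geo i).M → ∀ α₀ : ℝ, 0 < α₀ → (geo i).M * α₀ ≤ a₀ →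
        ∀ U : (bg i).Cfg, (bg i).Reg335 c35 α₀ U →
          (B9.Ineq342_346_347 (Gp i) B₀ δ₀ U ∧ B9.Ineq343_345 (Gp i) Bβ Bε Bεβ δ₀ U) →
          ∀ α₁ : ℝ, 0 < α₁ → α₁ ≤ a₁ → ∀ U' : (bg i).Cfg, (bg i).Cplx337 α₁ U U' →
            (B9.Ineq342_346_347 (Rem₁ i U) (C * α₁ * B₀') δ₀' ((bg i).mul U' U) ∧
              B9.Ineq343_345 (Rem₁ i U) (fun β => C * α₁ * Bβ' β) (fun ε => C * α₁ * Bε' ε)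
                (fun ε β => C * α₁ * Bεβ' ε β) δ₀' ((bg i).mul U' U)) ∧
            (B9.Ineq342_346_347 (Rem₂ i U) (C * α₁ * B₀') δ₀' ((bg i).mul U' U) ∧
              B9.Ineq343_345 (Rem₂ i U) (fun β => C * α₁ * Bβ' β) (fun ε => C * α₁ * Bε' ε)
                (fun ε β => C * α₁ * Bεβ' ε β) δ₀' ((bg i).mul U' U))

/-- **p. 403 [PDF 15]** (text layer `p0015.txt:L30–L32`), verbatim: «These results imply that the operators R(U),
P(U) = I − R(U) extend analytically to the domain (3.37) and satisfy the same bounds, e.g. the operator P(U′U) satisfies the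
bounds (3.49).»  («These results» = the analytic extensions of G′ and of (Q′(U)G′²(U)Q′*(U))⁻¹ with their bounds, (3.62)–(3.67),
obtained from Theorems 3.1, 3.2 at U; (3.49), p. 399 [PDF 11], verbatim: «[|P(x, x′)|, |(DP)_μ(x, x′)|, |(PD*)_ν(x, x′)|,
|(DPD*)_{μν}(x, x′)|] ≤ O(1)[1, (L^jη)⁻¹, (L^jη)⁻¹, (L^jη)⁻²](L^{j′}η)^{−d}e^{−(1/2)δ₀d(y,y′)} for x ∈ Δ(y), y ∈ Λ_j, x′ ∈ Δ(y′),
y′ ∈ Λ_{j′}» = `B9.Ineq349`.)  TYPED in the conditional frame of Sect. B (inputs at U: (3.42)–(3.47) for G′(U) and (3.48) for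
(Q′(U)G′²(U)Q′*(U))⁻¹ with their constants, the frame of `B9.SectBStepPrinted`): thresholds M₀, a₀, the radius a₁ > 0 and the
constants (C′, δ₀′) of (3.49) before the member; for M ≥ M₀, U satisfying (3.35) with Mα₀ ≤ a₀ at which the inputs hold,
and 0 < α₁ ≤ a₁: the fine kernel of P — the four entries of (3.49), a `B9.FineKernel` letter named by the user as in
`B9.Stmt349Printed` — is analytic in A on the class (3.37) with radius α₁ (`IsAnalyticExtF`, an abstract predicate exactly as
`IsAnalyticExt` of `B9.Thm34Printed`; R = I − P has the same extension), and (3.49) holds at every configuration U′U of the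
class (3.37) (`Cplx337 α₁ U U'`) with the constants (C′, δ₀′) («satisfy the same bounds»).  In tree, PROVED in concrete kernel
form and therefore cited, not restated: `B9Thm34PPrimeKernelFinal.thm34_R_kernel_final` ((3.49) for P(U′U) together with
(3.68)), `B9Thm34RFinal`; at U: `B9.Stmt349Printed` (typed).  The sentence as printed — analytic extension of R, P with
(3.49) on the class (3.37) at the family level — had no declaration (`B9.Thm34Printed` carries the extension clause for G′
and G only).  NEIGHBOUR (block 06, landed 2026-08-28): `B9Carve06Thms31to34Hyp.Thm34CinvRPrinted` types the analytic-extension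
clause of THEOREM 3.4 (p. 400) for (Q′G′²Q′*)⁻¹ and for P = I − R in the theorem's absolute frame with the SAME predicate
shape `IsAnalyticExtF` (pass one predicate to both bundles); the present def is the p. 403 sentence in Sect. B's
conditional frame and adds what that clause does not carry — «satisfy the same bounds»: (3.49) at every U′U of the class
(3.37). [cite: Balaban1985BackgroundPropagators, p.403 (after (3.67), before (3.68)) + (3.49) p.399] -/
def RPExtend349Printed {I : Type} (d : ℕ) (c35 : ℝ) (geo : I → B9.Geometry) (bg : I → B9.Backgrounds)
    (Gp : ∀ i, B9.KernelFamily (geo i) (bg i)) (Cinv : ∀ i, B9.SiteKernel (geo i) (bg i))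
    (P : ∀ i, B9.FineKernel (geo i) (bg i))
    (IsAnalyticExtF : ∀ i, B9.FineKernel (geo i) (bg i) → (bg i).Cfg → ℝ → Prop) : Prop :=
  ∀ (B₀ δ₀ : ℝ) (Bβ Bε : ℝ → ℝ) (Bεβ : ℝ → ℝ → ℝ) (B₁ δ₁ : ℝ),
    ∃ M₀ a₁ a₀ C' δ₀' : ℝ, 0 < M₀ ∧ 0 < a₁ ∧ 0 < a₀ ∧ 0 < C' ∧ 0 < δ₀' ∧
      ∀ i : I, M₀ ≤ (geo i).M → ∀ α₀ : ℝ, 0 < α₀ → (geo i).M * α₀ ≤ a₀ →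
        ∀ U : (bg i).Cfg, (bg i).Reg335 c35 α₀ U →
          (B9.Ineq342_346_347 (Gp i) B₀ δ₀ U ∧ B9.Ineq343_345 (Gp i) Bβ Bε Bεβ δ₀ U) →
          (∀ y y' : (geo i).Site, |(Cinv i).ker U y y'| ≤
              B₁ * ((geo i).len y) ^ (-(4 : ℝ)) * ((geo i).len y') ^ (-(d : ℝ)) *
                Real.exp (-(δ₁ * (geo i).dist y y'))) →
          ∀ α₁ : ℝ, 0 < α₁ → α₁ ≤ a₁ →
            IsAnalyticExtF i (P i) U α₁ ∧
            ∀ U' : (bg i).Cfg, (bg i).Cplx337 α₁ U U' → B9.Ineq349 d (P i) C' δ₀' ((bg i).mul U' U)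

/-! ## §2 The bundle keyed to `stmt-QuantumFields-20542` -/

/-- **BLOCK 07 OF [B9] (pp. 403–409) AS ONE HYPOTHESIS**, keyed to `stmt-QuantumFields-20542` (also feeds
`stmt-QuantumFields-19200`): the conjunction, BY NAME, of the section's printed statements in the cell's typed forms —
(1) the Sect. B step concluded on p. 407 [PDF 19] («Thus Theorem 3.4 is proved, assuming that Theorems 3.1–3.3 hold»)
`B9.SectBStepPrinted`; (2) the remainder sentence of p. 403 `Remainders365Printed`; (3) the R ∕ P sentence of p. 403
`RPExtend349Printed`; (4) the induction base quoted on p. 407 («we can use the results of [4]. There we have proved these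
theorems for operators with the external gauge field configuration U = 1») `B9.BaseU1Printed`; (5) Corollary 3.5 (p. 407)
`B9.Cor35Printed`; (6) the gauge reduction of Corollary 3.6's printed proof (pp. 407–408: «This follows from Corollary 3.5
applied to the configuration U′ = Uᵘ, and we have to recall only that all the results of these theorems are gauge invariant»)
`B9.GaugeReduction335`; (7) Corollary 3.6 (p. 408) `B9.Cor36Printed`; (8) Theorem 3.7 (p. 409) `B9.Thm37Printed`; (9) the
Sect. C summation leaf (p. 409 «This bound was a basis of all the remaining considerations in that paper, connected with the
convergence of the expansion (2.50), so we may apply them here also»; p. 410; p. 416) `B9.RWSumsYieldIneqs`.  A node prover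
takes `(h : Hyp …)`; the displays (3.63)–(3.89) are PROVED in the tree (INDEX in the module docstring) and are therefore not
hypotheses.  `InCube i` = the member's domains satisfy Ω′₀ ⊂ □ for a cube of the class of (3.35) (as in `B9.Cor36Printed`);
`E7`, `E10` = the expansion data of (3.90), (3.107) (`B9.RWExpansion`). [cite: Balaban1985BackgroundPropagators, Cor. 3.5 p.407 + Cor. 3.6 p.408 + Thm 3.7 (3.90) p.409 + Sect. B pp.402–407] -/
def Hyp {I : Type} (d : ℕ) (c35 : ℝ) (geo : I → B9.Geometry) (bg : I → B9.Backgrounds) (InCube : I → Prop)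
    (Gp GA : ∀ i, B9.KernelFamily (geo i) (bg i)) (Cinv : ∀ i, B9.SiteKernel (geo i) (bg i))
    (P : ∀ i, B9.FineKernel (geo i) (bg i)) (Rem₁ Rem₂ : ∀ i, (bg i).Cfg → B9.KernelFamily (geo i) (bg i))
    (IsAnalyticExt : ∀ i, B9.KernelFamily (geo i) (bg i) → (bg i).Cfg → ℝ → Prop)
    (IsAnalyticExtF : ∀ i, B9.FineKernel (geo i) (bg i) → (bg i).Cfg → ℝ → Prop)
    (E7 E10 : ∀ i, B9.RWExpansion (geo i) (bg i)) : Prop :=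
  B9.SectBStepPrinted d c35 geo bg Gp GA Cinv IsAnalyticExt ∧
  Remainders365Printed c35 geo bg Gp Rem₁ Rem₂ ∧
  RPExtend349Printed d c35 geo bg Gp Cinv P IsAnalyticExtF ∧
  B9.BaseU1Printed d geo bg Gp GA Cinv ∧
  B9.Cor35Printed d geo bg Gp GA Cinv ∧
  B9.GaugeReduction335 d c35 geo bg InCube Gp GA Cinv ∧
  B9.Cor36Printed d c35 geo bg InCube Gp GA Cinv ∧
  B9.Thm37Printed c35 geo bg E7 ∧
  B9.RWSumsYieldIneqs geo bg E7 E10 Gp GA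

/-! ## §3 How the bundle delivers the section's numbered statements (pointers; the theorems are the tree's, nothing new)

With `h : Hyp d c35 geo bg InCube Gp GA Cinv P Rem₁ Rem₂ IsAnalyticExt IsAnalyticExtF E7 E10` and its conjuncts numbered
(1)–(9) as in the docstring of `Hyp` (`obtain ⟨hB, hRem, hRP, hbase, h35, hg, h36, h37, hsum⟩ := h`):
* p. 407, Corollary 3.5's printed proof («Applying the results of that paper together with the above results we get
  Corollary 3.5»): (4) + (1) ⇒ (5) by `B9.cor35_of_sectB_base d c35 geo bg Gp GA Cinv IsAnalyticExt hone hbase hB`, given that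
  U ≡ 1 satisfies (3.35) for every α₀ > 0 (`hone`, a fact of any model: A = 0);
* p. 408, Corollary 3.6's printed proof: (5) + (6) ⇒ (7) by `B9.cor36_of_cor35 d c35 hc geo bg InCube Gp GA Cinv h35 hg`
  (for 0 < c35; print's O(1) = 12);
* p. 410 ll. 4–5 («Theorem 3.7 implies that all the inequalities (3.42)–(3.47) hold for G′, thus we have completed the proof of
  Theorem 3.1»): (8) + (9) ⇒ `B9.Thm31Printed c35 geo bg Gp` by `B9.thm31_of_thm37 c35 geo bg E7 E10 Gp GA h37 hsum`;
* p. 407 («Thus Theorem 3.4 is proved, assuming that Theorems 3.1–3.3 hold»): (1) + `B9.Thm32Printed` + `B9.Thm33Printed`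
  (blocks 06 ∕ 08 ∕ 09) ⇒ `B9.Thm34Printed c35 geo bg Gp GA IsAnalyticExt` by `B9.thm34_of_sectB`.
The redundancy inside `Hyp` (numbered statements next to their printed proof leaves) is print's own. -/

/-! ## §4 The §3 recipes, kernel-checked (v1.2): bookkeeping theorems over the bundle

Nothing printed is proved in this section: every step is a bookkeeping theorem of `…Balaban1983to89.B9`
(`B9.cor35_of_sectB_base`, `B9.cor36_of_cor35`, `B9.thm31_of_thm37`, `B9.thm32_of_thm39`, `B9.thm33_of_thm37_310`,
`B9.thm34_of_sectB`) applied to the conjuncts of `Hyp` BY NAME.  What §4 certifies beyond §1–§3: (a) the WIRING of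
`Hyp` — the carriers `Gp` ∕ `GA` ∕ `Cinv` ∕ `IsAnalyticExt` ∕ `E7` ∕ `E10` sit, conjunct by conjunct, in the slots the
tree's bookkeeping theorems expect, so the bundle delivers Theorem 3.1 (`Hyp.thm31`), Theorem 3.3 given block 09's
Theorem 3.10 leaf (`Hyp.thm33`), Theorem 3.4 given Theorems 3.2–3.3 (`Hyp.thm34`), and all four theorems given the
Sect. C leaves of blocks 08–09 (`Hyp.thms31to34`), each as typed in `…Balaban1983to89.B9`; (b) the MINIMAL LEAVES —
conjuncts (5) `B9.Cor35Printed` and (7) `B9.Cor36Printed` follow from (1), (4), (6) (print's own redundancy: the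
proof sentences of p. 407 and p. 408), so a prover who must SUPPLY the bundle proves seven leaves, not nine
(`hyp_of_leaves`, for 0 < c35 and given that U ≡ 1 satisfies (3.35)).  Dot access: with `h : Hyp …` write
`h.sectB`, …, `h.rwSums`, `h.thm31`, `h.thm33 h310`, `h.thm34 h32 h33`, `h.thms31to34 h39 hksum h310`. -/

section Delivery

variable {I : Type} {d : ℕ} {c35 : ℝ} {geo : I → B9.Geometry} {bg : I → B9.Backgrounds} {InCube : I → Prop}
  {Gp GA : ∀ i, B9.KernelFamily (geo i) (bg i)} {Cinv : ∀ i, B9.SiteKernel (geo i) (bg i)}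
  {P : ∀ i, B9.FineKernel (geo i) (bg i)} {Rem₁ Rem₂ : ∀ i, (bg i).Cfg → B9.KernelFamily (geo i) (bg i)}
  {IsAnalyticExt : ∀ i, B9.KernelFamily (geo i) (bg i) → (bg i).Cfg → ℝ → Prop}
  {IsAnalyticExtF : ∀ i, B9.FineKernel (geo i) (bg i) → (bg i).Cfg → ℝ → Prop}
  {E7 E10 : ∀ i, B9.RWExpansion (geo i) (bg i)}

/-- The bundle IS the nine-fold conjunction (1)–(9) of its docstring, definitionally (the printed statements of
pp. 403–409 by name; unfolding lemma, no content beyond `Hyp`). [cite: Balaban1985BackgroundPropagators, Cor. 3.5 p.407 + Cor. 3.6 p.408 + Thm 3.7 (3.90) p.409 + Sect. B pp.402–407] -/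
theorem hyp_iff :
    Hyp d c35 geo bg InCube Gp GA Cinv P Rem₁ Rem₂ IsAnalyticExt IsAnalyticExtF E7 E10 ↔
      B9.SectBStepPrinted d c35 geo bg Gp GA Cinv IsAnalyticExt ∧
      Remainders365Printed c35 geo bg Gp Rem₁ Rem₂ ∧
      RPExtend349Printed d c35 geo bg Gp Cinv P IsAnalyticExtF ∧
      B9.BaseU1Printed d geo bg Gp GA Cinv ∧
      B9.Cor35Printed d geo bg Gp GA Cinv ∧
      B9.GaugeReduction335 d c35 geo bg InCube Gp GA Cinv ∧
      B9.Cor36Printed d c35 geo bg InCube Gp GA Cinv ∧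
      B9.Thm37Printed c35 geo bg E7 ∧
      B9.RWSumsYieldIneqs geo bg E7 E10 Gp GA :=
  Iff.rfl

/-- Conjunct (1): the Sect. B step (p. 407 [PDF 19] «Thus Theorem 3.4 is proved, assuming that Theorems 3.1–3.3 hold»),
`B9.SectBStepPrinted`. [cite: Balaban1985BackgroundPropagators, Sect. B p.407] -/
theorem Hyp.sectB (h : Hyp d c35 geo bg InCube Gp GA Cinv P Rem₁ Rem₂ IsAnalyticExt IsAnalyticExtF E7 E10) :
    B9.SectBStepPrinted d c35 geo bg Gp GA Cinv IsAnalyticExt :=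
  h.1

/-- Conjunct (2): the remainder sentence of p. 403 [PDF 15], `Remainders365Printed`. [cite: Balaban1985BackgroundPropagators, p.403 lines 5–8] -/
theorem Hyp.remainders (h : Hyp d c35 geo bg InCube Gp GA Cinv P Rem₁ Rem₂ IsAnalyticExt IsAnalyticExtF E7 E10) :
    Remainders365Printed c35 geo bg Gp Rem₁ Rem₂ :=
  h.2.1

/-- Conjunct (3): the R ∕ P sentence of p. 403 [PDF 15], `RPExtend349Printed`. [cite: Balaban1985BackgroundPropagators, p.403 (after (3.67))] -/
theorem Hyp.rpExtend (h : Hyp d c35 geo bg InCube Gp GA Cinv P Rem₁ Rem₂ IsAnalyticExt IsAnalyticExtF E7 E10) :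
    RPExtend349Printed d c35 geo bg Gp Cinv P IsAnalyticExtF :=
  h.2.2.1

/-- Conjunct (4): the induction base U = 1 quoted on p. 407 [PDF 19], `B9.BaseU1Printed`. [cite: Balaban1985BackgroundPropagators, Cor. 3.5 proof p.407] -/
theorem Hyp.baseU1 (h : Hyp d c35 geo bg InCube Gp GA Cinv P Rem₁ Rem₂ IsAnalyticExt IsAnalyticExtF E7 E10) :
    B9.BaseU1Printed d geo bg Gp GA Cinv :=
  h.2.2.2.1

/-- Conjunct (5): Corollary 3.5 (p. 407 [PDF 19]), `B9.Cor35Printed`. [cite: Balaban1985BackgroundPropagators, Cor. 3.5 p.407] -/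
theorem Hyp.cor35 (h : Hyp d c35 geo bg InCube Gp GA Cinv P Rem₁ Rem₂ IsAnalyticExt IsAnalyticExtF E7 E10) :
    B9.Cor35Printed d geo bg Gp GA Cinv :=
  h.2.2.2.2.1

/-- Conjunct (6): the gauge reduction of Corollary 3.6's printed proof (pp. 407–408 [PDF 19–20]), `B9.GaugeReduction335`. [cite: Balaban1985BackgroundPropagators, Cor. 3.6 proof p.408] -/
theorem Hyp.gaugeReduction
    (h : Hyp d c35 geo bg InCube Gp GA Cinv P Rem₁ Rem₂ IsAnalyticExt IsAnalyticExtF E7 E10) :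
    B9.GaugeReduction335 d c35 geo bg InCube Gp GA Cinv :=
  h.2.2.2.2.2.1

/-- Conjunct (7): Corollary 3.6 (p. 408 [PDF 20]), `B9.Cor36Printed`. [cite: Balaban1985BackgroundPropagators, Cor. 3.6 p.408] -/
theorem Hyp.cor36 (h : Hyp d c35 geo bg InCube Gp GA Cinv P Rem₁ Rem₂ IsAnalyticExt IsAnalyticExtF E7 E10) :
    B9.Cor36Printed d c35 geo bg InCube Gp GA Cinv :=
  h.2.2.2.2.2.2.1

/-- Conjunct (8): Theorem 3.7 (3.90) (p. 409 [PDF 21]), `B9.Thm37Printed`. [cite: Balaban1985BackgroundPropagators, Thm 3.7 (3.90) p.409] -/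
theorem Hyp.thm37 (h : Hyp d c35 geo bg InCube Gp GA Cinv P Rem₁ Rem₂ IsAnalyticExt IsAnalyticExtF E7 E10) :
    B9.Thm37Printed c35 geo bg E7 :=
  h.2.2.2.2.2.2.2.1

/-- Conjunct (9): the Sect. C summation leaf (p. 409 «so we may apply them here also»; p. 410 ll. 1–5; p. 416),
`B9.RWSumsYieldIneqs`. [cite: Balaban1985BackgroundPropagators, Thm 3.7 proof p.409 + Thm 3.10 proof p.416] -/
theorem Hyp.rwSums (h : Hyp d c35 geo bg InCube Gp GA Cinv P Rem₁ Rem₂ IsAnalyticExt IsAnalyticExtF E7 E10) :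
    B9.RWSumsYieldIneqs geo bg E7 E10 Gp GA :=
  h.2.2.2.2.2.2.2.2

/-- **p. 410 [PDF 22] ll. 4–5, over the bundle** («Theorem 3.7 implies that all the inequalities (3.42)–(3.47) hold for
G′, thus we have completed the proof of Theorem 3.1»): conjuncts (8) + (9) give Theorem 3.1 as typed (`B9.Thm31Printed`),
by the tree's `B9.thm31_of_thm37`. [cite: Balaban1985BackgroundPropagators, Thm 3.7 ⇒ Thm 3.1 p.410] -/
theorem Hyp.thm31 (h : Hyp d c35 geo bg InCube Gp GA Cinv P Rem₁ Rem₂ IsAnalyticExt IsAnalyticExtF E7 E10) :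
    B9.Thm31Printed c35 geo bg Gp :=
  B9.thm31_of_thm37 c35 geo bg E7 E10 Gp GA h.thm37 h.rwSums

/-- **p. 416 [PDF 28], over the bundle** («This implies Theorem 3.3. Thus we have completed the proofs of all theorems
formulated until now»): conjuncts (8) + (9) and BLOCK 09's Theorem 3.10 leaf `B9.Thm310Printed` (the G-half of the
summation leaf (9) is Theorem 3.10's) give Theorem 3.3 as typed (`B9.Thm33Printed`), by the tree's
`B9.thm33_of_thm37_310`. [cite: Balaban1985BackgroundPropagators, Thm 3.10 ⇒ Thm 3.3 p.416] -/
theorem Hyp.thm33 (h : Hyp d c35 geo bg InCube Gp GA Cinv P Rem₁ Rem₂ IsAnalyticExt IsAnalyticExtF E7 E10)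
    (h310 : B9.Thm310Printed c35 geo bg E10) : B9.Thm33Printed c35 geo bg Gp GA :=
  B9.thm33_of_thm37_310 c35 geo bg E7 E10 Gp GA h.thm37 h310 h.rwSums

/-- **p. 407 [PDF 19], over the bundle** («Thus Theorem 3.4 is proved, assuming that Theorems 3.1–3.3 hold»): conjunct (1)
and Theorems 3.2, 3.3 as typed (`B9.Thm32Printed`, block 06 ∕ 08; `B9.Thm33Printed`, which carries Theorem 3.1's block
for G′, blocks 06 ∕ 09 or `Hyp.thm33`) give Theorem 3.4 as typed (`B9.Thm34Printed`), by the tree's `B9.thm34_of_sectB`.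
[cite: Balaban1985BackgroundPropagators, Sect. B p.407] -/
theorem Hyp.thm34 (h : Hyp d c35 geo bg InCube Gp GA Cinv P Rem₁ Rem₂ IsAnalyticExt IsAnalyticExtF E7 E10)
    (h32 : B9.Thm32Printed d c35 geo bg Cinv) (h33 : B9.Thm33Printed c35 geo bg Gp GA) :
    B9.Thm34Printed c35 geo bg Gp GA IsAnalyticExt :=
  B9.thm34_of_sectB d c35 geo bg Gp GA Cinv IsAnalyticExt h.sectB h32 h33

/-- **Block 07 and the Sect. C leaves of blocks 08–09 give Theorems 3.1–3.4 as typed** (pp. 407, 410, 413, 416: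
«Thus Theorem 3.4 is proved, assuming …», «… thus we have completed the proof of Theorem 3.1», «This theorem implies
Theorem 3.2», «This implies Theorem 3.3»): the bundle, BLOCK 08's Theorem 3.9 `B9.Thm39Printed` with its
kernel-summation leaf `B9.RWKernelSumYields`, and BLOCK 09's Theorem 3.10 `B9.Thm310Printed` deliver
`B9.Thm31Printed ∧ B9.Thm32Printed ∧ B9.Thm33Printed ∧ B9.Thm34Printed` — the tree's `B9.thm32_of_thm39` and the
three theorems above; compare the tree's leaf-level `B9.sectsAC_architecture`. [cite: Balaban1985BackgroundPropagators, Sects. B–C pp.407–416] -/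
theorem Hyp.thms31to34 (h : Hyp d c35 geo bg InCube Gp GA Cinv P Rem₁ Rem₂ IsAnalyticExt IsAnalyticExtF E7 E10)
    {E9 : ∀ i, B9.RWKernelExpansion (geo i) (bg i)} (h39 : B9.Thm39Printed d c35 geo bg E9)
    (hksum : B9.RWKernelSumYields d geo bg E9 Cinv) (h310 : B9.Thm310Printed c35 geo bg E10) :
    B9.Thm31Printed c35 geo bg Gp ∧ B9.Thm32Printed d c35 geo bg Cinv ∧ B9.Thm33Printed c35 geo bg Gp GA ∧
      B9.Thm34Printed c35 geo bg Gp GA IsAnalyticExt :=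
  have h32 := B9.thm32_of_thm39 d c35 geo bg E9 Cinv h39 hksum
  have h33 := h.thm33 h310
  ⟨h.thm31, h32, h33, h.thm34 h32 h33⟩

/-- **The bundle from its seven independent leaves** (print's redundancy made explicit, kernel-checked): conjunct (5)
Corollary 3.5 follows from (4) + (1) by its printed proof (p. 407 [PDF 19] «Applying the results of that paper together
with the above results we get Corollary 3.5»; the tree's `B9.cor35_of_sectB_base`, given that U ≡ 1 satisfies (3.35) for
every α₀ > 0 — `hone`, A = 0 in any model), and conjunct (7) Corollary 3.6 from (5) + (6) by its printed proof (p. 408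
[PDF 20] «This follows from Corollary 3.5 applied to the configuration U′ = Uᵘ …»; the tree's `B9.cor36_of_cor35`, for
0 < c35 — print's O(1) = 12, p. 409).  So the leaves (1), (2), (3), (4), (6), (8), (9) give `Hyp`. [cite: Balaban1985BackgroundPropagators, Cor. 3.5 proof p.407 + Cor. 3.6 proof p.408] -/
theorem hyp_of_leaves (hc : 0 < c35)
    (hone : ∀ i : I, ∀ α₀ : ℝ, 0 < α₀ → (bg i).Reg335 c35 α₀ (bg i).one)
    (hB : B9.SectBStepPrinted d c35 geo bg Gp GA Cinv IsAnalyticExt)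
    (hRem : Remainders365Printed c35 geo bg Gp Rem₁ Rem₂)
    (hRP : RPExtend349Printed d c35 geo bg Gp Cinv P IsAnalyticExtF)
    (hbase : B9.BaseU1Printed d geo bg Gp GA Cinv)
    (hg : B9.GaugeReduction335 d c35 geo bg InCube Gp GA Cinv)
    (h37 : B9.Thm37Printed c35 geo bg E7) (hsum : B9.RWSumsYieldIneqs geo bg E7 E10 Gp GA) :
    Hyp d c35 geo bg InCube Gp GA Cinv P Rem₁ Rem₂ IsAnalyticExt IsAnalyticExtF E7 E10 :=
  have h35 : B9.Cor35Printed d geo bg Gp GA Cinv :=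
    B9.cor35_of_sectB_base d c35 geo bg Gp GA Cinv IsAnalyticExt hone hbase hB
  ⟨hB, hRem, hRP, hbase, h35, hg, B9.cor36_of_cor35 d c35 hc geo bg InCube Gp GA Cinv h35 hg, h37, hsum⟩

end Delivery

end Literature.MathematicalPhysics.QuantumFieldTheory.Balaban1983to89.B9Carve07Thm37Hyp
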